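import Summits.Ventures.LatticeQCDFlow.Scaling.HubChainStartContentDeficit

/-!
HONEST FRAMING: exact (Metropolis-corrected) sampling algorithms for lattice gauge theory; figures
of merit are autocorrelation/cost numbers at stated couplings and volumes; no continuum-physics
claim.

# HubChainStartContentDeficitSharp — THE START-CLASS DEFICIT OBEYS AN EXACT ONE-STEP RECURSION; AT A START DEEPER THAN THE TAG (THREE PARTICLES AT RANKS `≤ i`) IT IS
# `≤ (β^X_i − β^Y_i)·(max{0,−β^X_i})ⁿ⁻¹` AT EVEN `n` AND `≤ 0` AT ODD `n` — IT VANISHES IDENTICALLY AS SOON AS THE START CLASS'S EIGENVALUE IN `X` IS NON-NEGATIVE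
# (lean-2 GEN-41, ours)

Venture-side (OURS).  Cell `lqcd-flow` (pub-lqcd), unit `pub-lqcd-lean-2-g41`, 2026-08-30.  Chapter AA (route (β) of OPEN-MATH (b′): the cost side), file 1.  Setting of Z2∕Z5
(class chain `P(i,j) = cN_j·min{1,ρ_j/ρ_i}` on depth ranks `< m`, two sorted depth profiles `ρ^X, ρ^Y` agreeing off the tag rank `s`, `ρ^X_s ≤ ρ^Y_s`; start class `i` with
`s < i`).  Z5 bounded the per-step start-class deficit `e_n = P_Yⁿ(i,i) − P_Xⁿ(i,i)` by the parity term `(β^Y_i)ⁿ − (β^X_i)ⁿ ≤ (max{0,−β^Y_i})ⁿ`.  Here: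

* §1 `sharp_col_eq`: every column entry INTO the start class agrees, `P_Y(l,i) = P_X(l,i)` (`l ≠ i`; at `l = s` both are `cN_i` since `ρ_s ≤ ρ_i`); `sharp_gamma_eq`,
  `sharp_diag_sub`: the only entry of row∕column `i` that moves is the diagonal, `P_X(i,i) − P_Y(i,i) = β^X_i − β^Y_i = cN_s(ρ^Y_s − ρ^X_s)/ρ_i =: γ ≥ 0`.
* §2 **`sharp_deficit_succ` (EXACT ONE-STEP RECURSION):**
  `e_{n+1} = −Σ_{l∉{i,s}}(P_Xⁿ(i,l) − P_Yⁿ(i,l))·P_X(l,i) + e_n·P_Y(i,i) + cN_iN_sρ^Y_s·(T^Y_n(i) − T^X_n(i)) − γ·(β^X_i)ⁿ`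
  (first-step expansion at the LAST step, §1, and Y8's Smith–Tierney forms `P_Xⁿ(i,s) = N_sρ^X_sT^X_n(i)`, `P_Xⁿ(i,i) = N_iρ_iT^X_n(i) + (β^X_i)ⁿ`: the tag column's surplus
  `cN_i(P_Yⁿ(i,s) − P_Xⁿ(i,s))` and the extra holding `γP_Xⁿ(i,i)` combine into a `T`-difference and a pure eigenvalue power).
* §3 **`sharp_deficit_succ_le`:** with three particles at ranks `≤ i` (`M_{i+1} + 3 ≤ M_0`, `cM_0 ≤ 1 + c`, `N_i ≥ 1`) the first three terms are signed (Z2 `perStep_pow_le`,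
  `perStep_T_le_deep`, `P ≥ 0`): `e_{n+1} ≤ max{0,e_n}·P_Y(i,i) − γ(β^X_i)ⁿ`.  Hence **`sharp_deficit_odd`** (`e_n ≤ 0` for odd `n`, Z5) and **`sharp_deficit_even`**: for odd `k`,
  `e_{k+1} ≤ γ·(max{0,−β^X_i})ᵏ`; uniformly **`sharp_deficit_le`**: `e_n ≤ γ·(max{0,−β^X_i})ⁿ⁻¹` (`n ≥ 1`), with `γ ≤ c·N_s·… `, `0 ≤ γ` (`sharp_gamma_nonneg`) and
  `max{0,−β^X_i} ≤ c` (Z5); **`sharp_deficit_le_of_nonneg`**: `β^X_i ≥ 0 ⇒ P_Yⁿ(i,i) ≤ P_Xⁿ(i,i)` for EVERY `n` (Z5 needed `β^Y_i ≥ 0`).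
  Compared with Z5's `(β^Y)ⁿ − (β^X)ⁿ = γ·Σ_t(β^Y)ᵗ(β^X)ⁿ⁻¹⁻ᵗ` the new bound keeps only the smallest term `γ|β^X|ⁿ⁻¹`: the deficit is governed by the SMALLER modulus `|β^X_i|`
  (for the star: `|β^X_ζ| ≤ acc(ζ,a)/K`, tiny when `X`'s extra particle is much more persistent than the hub content) — toy: the bound is attained (ratio → 1).

Route (β) (memo MEMO-gen41): `D = Σ_j w_j e_j⁺ ≤ γ(1−σ)σ|β^X|/(1 − σ²(β^X)²)`, and the cost-side inequality `L·D ≤ L·gap_a + 2s1 + s2 + s3` in this regime reduces to an explicit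
two-step inequality on `X`'s certificate slack (toy margin ≥ 0.19; not typed here).  Literature grade (cell rule): OWN, elementary; nothing cited; no new bib keys.
-/

open Finset

namespace Summit.Ventures.LatticeQCDFlow.Scaling

section Sharp
variable {m s : ℕ} {ρX ρY N RX RY M βX βY a : ℕ → ℝ} {c : ℝ} {PX PY fX fY : ℕ → ℕ → ℝ} {PnX PnY : ℕ → ℕ → ℕ → ℝ} {TX TY : ℕ → ℕ → ℝ}

/-! ### §1 The kernels differ only at the diagonal entry of the start class (within row and column `i`) -/

/-- **Every entry INTO the start class agrees:** `P_Y(l,i) = P_X(l,i)` for `l ≠ i` (`s < i`: from the tag both are `cN_i`). [ours] -/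
theorem sharp_col_eq (hρX : ∀ i, 0 < ρX i) (hmonoX : Monotone ρX) (hρY : ∀ i, 0 < ρY i) (hmonoY : Monotone ρY)
    (hagree : ∀ i, i ≠ s → ρX i = ρY i)
    (hPXoff : ∀ i j, i ≠ j → PX i j = c * N j * min 1 (ρX j / ρX i)) (hPYoff : ∀ i j, i ≠ j → PY i j = c * N j * min 1 (ρY j / ρY i))
    {i : ℕ} (hsi : s < i) {l : ℕ} (hli : l ≠ i) : PY l i = PX l i := by
  rw [hPXoff l i hli, hPYoff l i hli]
  by_cases hls : l = s
  · subst hls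
    have hX : 1 ≤ ρX i / ρX l := (one_le_div (hρX l)).mpr (hmonoX hsi.le)
    have hY : 1 ≤ ρY i / ρY l := (one_le_div (hρY l)).mpr (hmonoY hsi.le)
    rw [min_eq_left hX, min_eq_left hY]
  · rw [hagree l hls, hagree i (ne_of_gt hsi)]

/-- **`γ = β^X_i − β^Y_i = cN_s(ρ^Y_s − ρ^X_s)/ρ_i`** (`s < i`). [ours] -/
theorem sharp_gamma_eq (hagree : ∀ i, i ≠ s → ρX i = ρY i)
    (hRX : ∀ k, RX k = ∑ i ∈ range k, N i * ρX i) (hRY : ∀ k, RY k = ∑ i ∈ range k, N i * ρY i)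
    (hβX : ∀ k, βX k = 1 - c * (M k + RX k / ρX k)) (hβY : ∀ k, βY k = 1 - c * (M k + RY k / ρY k)) {i : ℕ} (hsi : s < i) :
    βX i - βY i = c * N s * (ρY s - ρX s) / ρX i := by
  have hR : RY i = RX i + N s * (ρY s - ρX s) := by
    rw [hRY, hRX]
    have hs : s ∈ range i := mem_range.mpr hsi
    rw [← add_sum_erase _ _ hs, ← add_sum_erase _ _ hs]
    have : ∑ x ∈ (range i).erase s, N x * ρY x = ∑ x ∈ (range i).erase s, N x * ρX x :=
      sum_congr rfl fun x hx => by rw [hagree x (ne_of_mem_erase hx)]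
    rw [this]; ring
  rw [hβX, hβY, ← hagree i (ne_of_gt hsi), hR]
  ring

/-- `γ ≥ 0`. [ours] -/
theorem sharp_gamma_nonneg (hρY : ∀ i, 0 < ρY i) (hagree : ∀ i, i ≠ s → ρX i = ρY i) (htag : ρX s ≤ ρY s) (hN : ∀ i, 0 < N i)
    (hRX : ∀ k, RX k = ∑ i ∈ range k, N i * ρX i) (hRY : ∀ k, RY k = ∑ i ∈ range k, N i * ρY i)
    (hβX : ∀ k, βX k = 1 - c * (M k + RX k / ρX k)) (hβY : ∀ k, βY k = 1 - c * (M k + RY k / ρY k)) (hc : 0 ≤ c)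
    {i : ℕ} (hsi : s < i) : 0 ≤ βX i - βY i := by
  linarith [perStep_beta_le hρY hagree htag hN hRX hRY hβX hβY hc hsi]

/-- **The diagonal entry of the start class:** `P_X(i,i) − P_Y(i,i) = β^X_i − β^Y_i` (Y7 `P(i,i) = β_i + cN_i`). [ours] -/
theorem sharp_diag_sub (hρX : ∀ i, 0 < ρX i) (hmonoX : Monotone ρX) (hρY : ∀ i, 0 < ρY i) (hmonoY : Monotone ρY)
    (hRX : ∀ k, RX k = ∑ i ∈ range k, N i * ρX i) (hRY : ∀ k, RY k = ∑ i ∈ range k, N i * ρY i) (hM : ∀ k, M k = ∑ i ∈ Ico k m, N i)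
    (hPXoff : ∀ i j, i ≠ j → PX i j = c * N j * min 1 (ρX j / ρX i)) (hPXdiag : ∀ i, PX i i = 1 - ∑ j ∈ (range m).erase i, PX i j)
    (hPYoff : ∀ i j, i ≠ j → PY i j = c * N j * min 1 (ρY j / ρY i)) (hPYdiag : ∀ i, PY i i = 1 - ∑ j ∈ (range m).erase i, PY i j)
    (hβX : ∀ k, βX k = 1 - c * (M k + RX k / ρX k)) (hβY : ∀ k, βY k = 1 - c * (M k + RY k / ρY k)) {i : ℕ} (hi : i < m) :
    PX i i - PY i i = βX i - βY i := by
  rw [hubClass_diag hρX hmonoX hRX hM hPXoff hPXdiag hβX hi, hubClass_diag hρY hmonoY hRY hM hPYoff hPYdiag hβY hi]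
  ring

/-! ### §2 The exact one-step recursion -/

/-- **THE START-CLASS DEFICIT, ONE STEP LATER (exact):**
`e_{n+1} = −Σ_{l∉{i,s}}(P_Xⁿ(i,l) − P_Yⁿ(i,l))P_X(l,i) + e_n·P_Y(i,i) + cN_iN_sρ^Y_s(T^Y_n(i) − T^X_n(i)) − (β^X_i − β^Y_i)(β^X_i)ⁿ`. [ours] -/
theorem sharp_deficit_succ (hρX : ∀ i, 0 < ρX i) (hmonoX : Monotone ρX) (hρY : ∀ i, 0 < ρY i) (hmonoY : Monotone ρY)
    (hagree : ∀ i, i ≠ s → ρX i = ρY i) (hN : ∀ i, 0 < N i)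
    (hRX : ∀ k, RX k = ∑ i ∈ range k, N i * ρX i) (hRY : ∀ k, RY k = ∑ i ∈ range k, N i * ρY i) (hM : ∀ k, M k = ∑ i ∈ Ico k m, N i)
    (hPXoff : ∀ i j, i ≠ j → PX i j = c * N j * min 1 (ρX j / ρX i)) (hPXdiag : ∀ i, PX i i = 1 - ∑ j ∈ (range m).erase i, PX i j)
    (hPYoff : ∀ i j, i ≠ j → PY i j = c * N j * min 1 (ρY j / ρY i)) (hPYdiag : ∀ i, PY i i = 1 - ∑ j ∈ (range m).erase i, PY i j)
    (hfX : ∀ k i, fX k i = if i < k then ρX k else if i = k then -(RX k / N k) else 0)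
    (hfY : ∀ k i, fY k i = if i < k then ρY k else if i = k then -(RY k / N k) else 0)
    (hβX : ∀ k, βX k = 1 - c * (M k + RX k / ρX k)) (hβY : ∀ k, βY k = 1 - c * (M k + RY k / ρY k))
    (hPX0 : ∀ i j, PnX 0 i j = if i = j then 1 else 0) (hPXs : ∀ n i j, PnX (n + 1) i j = ∑ l ∈ range m, PnX n i l * PX l j)
    (hPY0 : ∀ i j, PnY 0 i j = if i = j then 1 else 0) (hPYs : ∀ n i j, PnY (n + 1) i j = ∑ l ∈ range m, PnY n i l * PY l j)
    (hTX : ∀ n j, TX n j = (1 - βX j ^ n) / RX m + ∑ k ∈ Ico (j + 1) m, (1 / RX k - 1 / RX (k + 1)) * (βX k ^ n - βX j ^ n))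
    (hTY : ∀ n j, TY n j = (1 - βY j ^ n) / RY m + ∑ k ∈ Ico (j + 1) m, (1 / RY k - 1 / RY (k + 1)) * (βY k ^ n - βY j ^ n))
    (n : ℕ) {i : ℕ} (hsi : s < i) (hi : i < m) :
    PnY (n + 1) i i - PnX (n + 1) i i
      = -(∑ l ∈ ((range m).erase i).erase s, (PnX n i l - PnY n i l) * PX l i) + (PnY n i i - PnX n i i) * PY i i
        + c * N i * N s * ρY s * (TY n i - TX n i) - (βX i - βY i) * βX i ^ n := by
  have hs : s < m := hsi.trans hi
  have his : i ≠ s := ne_of_gt hsi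
  -- the one-step expansion, split at `l = i` and `l = s`
  have hi_mem : i ∈ range m := mem_range.mpr hi
  have hs_mem : s ∈ (range m).erase i := mem_erase.mpr ⟨ne_of_lt hsi |>.symm |> fun h => by omega, mem_range.mpr hs⟩
  have split : ∀ (g : ℕ → ℝ), ∑ l ∈ range m, g l = g i + g s + ∑ l ∈ ((range m).erase i).erase s, g l := by
    intro g; rw [← add_sum_erase _ _ hi_mem, ← add_sum_erase _ _ hs_mem]; ring
  rw [hPYs n i i, hPXs n i i, split, split]
  -- column entries agree off the diagonal
  have hcol : ∀ l, l ≠ i → PY l i = PX l i := fun l hli => sharp_col_eq hρX hmonoX hρY hmonoY hagree hPXoff hPYoff hsi hli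
  have hrest : ∑ l ∈ ((range m).erase i).erase s, PnY n i l * PY l i - ∑ l ∈ ((range m).erase i).erase s, PnX n i l * PX l i
      = -(∑ l ∈ ((range m).erase i).erase s, (PnX n i l - PnY n i l) * PX l i) := by
    rw [← sum_sub_distrib, ← sum_neg_distrib]
    refine sum_congr rfl fun l hl => ?_
    have hli : l ≠ i := ne_of_mem_erase (mem_of_mem_erase hl)
    rw [hcol l hli]; ring
  -- the tag column and the diagonal
  have hPs : PX s i = c * N i := by
    rw [hPXoff s i (ne_of_lt hsi), min_eq_left ((one_le_div (hρX s)).mpr (hmonoX hsi.le))]; ring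
  have hPsY : PY s i = c * N i := by rw [hcol s (ne_of_lt hsi), hPs]
  have hdiag : PX i i = PY i i + (βX i - βY i) := by
    linarith [sharp_diag_sub hρX hmonoX hρY hmonoY hRX hRY hM hPXoff hPXdiag hPYoff hPYdiag hβX hβY hi]
  -- Smith–Tierney forms
  have hXis := hubClass_pow_offdiag hρX hmonoX hN hRX hM hPXoff hPXdiag hfX hβX hPX0 hPXs hTX n hi hs his
  have hYis := hubClass_pow_offdiag hρY hmonoY hN hRY hM hPYoff hPYdiag hfY hβY hPY0 hPYs hTY n hi hs his
  rw [max_eq_left hsi.le] at hXis hYis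
  have hXii := hubClass_pow_diag hρX hmonoX hN hRX hM hPXoff hPXdiag hfX hβX hPX0 hPXs hTX n hi
  have hγ := sharp_gamma_eq hagree hRX hRY hβX hβY hsi
  have hρi : ρX i ≠ 0 := (hρX i).ne'
  -- assemble
  have key : PnY n i s * PY s i - PnX n i s * PX s i - (βX i - βY i) * PnX n i i
      = c * N i * N s * ρY s * (TY n i - TX n i) - (βX i - βY i) * βX i ^ n := by
    rw [hPs, hPsY, hXis, hYis, hXii, hγ]
    field_simp
    ring
  calc PnY n i i * PY i i + PnY n i s * PY s i + ∑ l ∈ ((range m).erase i).erase s, PnY n i l * PY l i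
        - (PnX n i i * PX i i + PnX n i s * PX s i + ∑ l ∈ ((range m).erase i).erase s, PnX n i l * PX l i)
      = (∑ l ∈ ((range m).erase i).erase s, PnY n i l * PY l i - ∑ l ∈ ((range m).erase i).erase s, PnX n i l * PX l i)
        + (PnY n i i - PnX n i i) * PY i i + (PnY n i s * PY s i - PnX n i s * PX s i - (βX i - βY i) * PnX n i i) := by
          rw [hdiag]; ring
    _ = _ := by rw [hrest, key]; ring

/-! ### §3 The sharp bounds at a deep start -/

/-- **One step, signed:** with three particles at ranks `≤ i`, `e_{n+1} ≤ max{0,e_n}·P_Y(i,i) − (β^X_i − β^Y_i)(β^X_i)ⁿ`. [ours] -/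
theorem sharp_deficit_succ_le (hρX : ∀ i, 0 < ρX i) (hmonoX : Monotone ρX) (hρY : ∀ i, 0 < ρY i) (hmonoY : Monotone ρY)
    (hagree : ∀ i, i ≠ s → ρX i = ρY i) (htag : ρX s ≤ ρY s) (hN : ∀ i, 0 < N i)
    (hRX : ∀ k, RX k = ∑ i ∈ range k, N i * ρX i) (hRY : ∀ k, RY k = ∑ i ∈ range k, N i * ρY i) (hM : ∀ k, M k = ∑ i ∈ Ico k m, N i)
    (hPXoff : ∀ i j, i ≠ j → PX i j = c * N j * min 1 (ρX j / ρX i)) (hPXdiag : ∀ i, PX i i = 1 - ∑ j ∈ (range m).erase i, PX i j)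
    (hPYoff : ∀ i j, i ≠ j → PY i j = c * N j * min 1 (ρY j / ρY i)) (hPYdiag : ∀ i, PY i i = 1 - ∑ j ∈ (range m).erase i, PY i j)
    (hfX : ∀ k i, fX k i = if i < k then ρX k else if i = k then -(RX k / N k) else 0)
    (hfY : ∀ k i, fY k i = if i < k then ρY k else if i = k then -(RY k / N k) else 0)
    (hβX : ∀ k, βX k = 1 - c * (M k + RX k / ρX k)) (hβY : ∀ k, βY k = 1 - c * (M k + RY k / ρY k)) (ha : ∀ l, a l = 1 - c * M (l + 1))
    (hPX0 : ∀ i j, PnX 0 i j = if i = j then 1 else 0) (hPXs : ∀ n i j, PnX (n + 1) i j = ∑ l ∈ range m, PnX n i l * PX l j)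
    (hPY0 : ∀ i j, PnY 0 i j = if i = j then 1 else 0) (hPYs : ∀ n i j, PnY (n + 1) i j = ∑ l ∈ range m, PnY n i l * PY l j)
    (hTX : ∀ n j, TX n j = (1 - βX j ^ n) / RX m + ∑ k ∈ Ico (j + 1) m, (1 / RX k - 1 / RX (k + 1)) * (βX k ^ n - βX j ^ n))
    (hTY : ∀ n j, TY n j = (1 - βY j ^ n) / RY m + ∑ k ∈ Ico (j + 1) m, (1 / RY k - 1 / RY (k + 1)) * (βY k ^ n - βY j ^ n))
    (hc : 0 ≤ c) (hcK : c * M 0 ≤ 1 + c) (n : ℕ) {i : ℕ} (hsi : s < i) (hi : i < m) (h3 : M (i + 1) + 3 ≤ M 0) (hNi : 1 ≤ N i) :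
    PnY (n + 1) i i - PnX (n + 1) i i ≤ max 0 (PnY n i i - PnX n i i) * PY i i - (βX i - βY i) * βX i ^ n := by
  have hs : s < m := hsi.trans hi
  rw [sharp_deficit_succ hρX hmonoX hρY hmonoY hagree hN hRX hRY hM hPXoff hPXdiag hPYoff hPYdiag hfX hfY hβX hβY hPX0 hPXs hPY0 hPYs hTX hTY n hsi hi]
  -- (1) the gap terms are `≥ 0`
  have hgap : 0 ≤ ∑ l ∈ ((range m).erase i).erase s, (PnX n i l - PnY n i l) * PX l i := by
    refine sum_nonneg fun l hl => ?_
    have hls : l ≠ s := ne_of_mem_erase hl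
    have hl' := mem_of_mem_erase hl
    have hli : l ≠ i := ne_of_mem_erase hl'
    have hlm : l < m := mem_range.mp (mem_of_mem_erase hl')
    have h3' : M (max (max i l) s + 1) + 3 ≤ M 0 := by
      have hle : i ≤ max (max i l) s := le_trans (le_max_left _ _) (le_max_left _ _)
      have := perStep_M_anti hN hM (Nat.succ_le_succ hle)
      linarith
    have hdom := perStep_pow_le hρX hmonoX hρY hmonoY hagree htag hN hRX hRY hM hPXoff hPXdiag hPYoff hPYdiag hfX hfY hβX hβY ha hPX0 hPXs hPY0 hPYs
      hTX hTY hc hcK n hi hlm hs (Ne.symm hli) (ne_of_gt hsi) hls h3'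
    have hP : 0 ≤ PX l i := by
      rw [hPXoff l i hli]
      exact mul_nonneg (mul_nonneg hc (hN i).le) (le_min zero_le_one (div_nonneg (hρX i).le (hρX l).le))
    exact mul_nonneg (by linarith) hP
  -- (2) the `T`-difference is `≤ 0`
  have hT := perStep_T_le_deep hρX hρY hmonoY hagree htag hN hRX hRY hM hβX hβY ha hTX hTY hc hcK n hsi hi h3
  have hT' : c * N i * N s * ρY s * (TY n i - TX n i) ≤ 0 :=
    mul_nonpos_of_nonneg_of_nonpos (mul_nonneg (mul_nonneg (mul_nonneg hc (hN i).le) (hN s).le) (hρY s).le) (by linarith)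
  -- (3) the diagonal of `Y` is `≥ 0`
  have hPY : 0 ≤ PY i i := by
    refine hubClass_diag_nonneg hρY hmonoY hN hRY hM hPYoff hPYdiag hβY hc hi ?_
    nlinarith
  have hmax : (PnY n i i - PnX n i i) * PY i i ≤ max 0 (PnY n i i - PnX n i i) * PY i i :=
    mul_le_mul_of_nonneg_right (le_max_right _ _) hPY
  linarith

/-- **Odd `n`: no deficit** (`e_n ≤ (β^Y_i)ⁿ − (β^X_i)ⁿ ≤ 0`, Z5). [ours] -/
theorem sharp_deficit_odd (hρX : ∀ i, 0 < ρX i) (hmonoX : Monotone ρX) (hρY : ∀ i, 0 < ρY i) (hmonoY : Monotone ρY)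
    (hagree : ∀ i, i ≠ s → ρX i = ρY i) (htag : ρX s ≤ ρY s) (hN : ∀ i, 0 < N i)
    (hRX : ∀ k, RX k = ∑ i ∈ range k, N i * ρX i) (hRY : ∀ k, RY k = ∑ i ∈ range k, N i * ρY i) (hM : ∀ k, M k = ∑ i ∈ Ico k m, N i)
    (hPXoff : ∀ i j, i ≠ j → PX i j = c * N j * min 1 (ρX j / ρX i)) (hPXdiag : ∀ i, PX i i = 1 - ∑ j ∈ (range m).erase i, PX i j)
    (hPYoff : ∀ i j, i ≠ j → PY i j = c * N j * min 1 (ρY j / ρY i)) (hPYdiag : ∀ i, PY i i = 1 - ∑ j ∈ (range m).erase i, PY i j)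
    (hfX : ∀ k i, fX k i = if i < k then ρX k else if i = k then -(RX k / N k) else 0)
    (hfY : ∀ k i, fY k i = if i < k then ρY k else if i = k then -(RY k / N k) else 0)
    (hβX : ∀ k, βX k = 1 - c * (M k + RX k / ρX k)) (hβY : ∀ k, βY k = 1 - c * (M k + RY k / ρY k)) (ha : ∀ l, a l = 1 - c * M (l + 1))
    (hPX0 : ∀ i j, PnX 0 i j = if i = j then 1 else 0) (hPXs : ∀ n i j, PnX (n + 1) i j = ∑ l ∈ range m, PnX n i l * PX l j)
    (hPY0 : ∀ i j, PnY 0 i j = if i = j then 1 else 0) (hPYs : ∀ n i j, PnY (n + 1) i j = ∑ l ∈ range m, PnY n i l * PY l j)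
    (hTX : ∀ n j, TX n j = (1 - βX j ^ n) / RX m + ∑ k ∈ Ico (j + 1) m, (1 / RX k - 1 / RX (k + 1)) * (βX k ^ n - βX j ^ n))
    (hTY : ∀ n j, TY n j = (1 - βY j ^ n) / RY m + ∑ k ∈ Ico (j + 1) m, (1 / RY k - 1 / RY (k + 1)) * (βY k ^ n - βY j ^ n))
    (hc : 0 ≤ c) (hcK : c * M 0 ≤ 1 + c) {n : ℕ} (hn : Odd n) {i : ℕ} (hsi : s < i) (hi : i < m) (h3 : M (i + 1) + 3 ≤ M 0) :
    PnY n i i - PnX n i i ≤ 0 := by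
  have h := startClass_deep_sub_le hρX hmonoX hρY hmonoY hagree htag hN hRX hRY hM hPXoff hPXdiag hPYoff hPYdiag hfX hfY hβX hβY ha hPX0 hPXs hPY0 hPYs hTX hTY
    hc hcK n hsi hi h3
  have hβ := perStep_beta_le hρY hagree htag hN hRX hRY hβX hβY hc hsi
  have hmono : βY i ^ n ≤ βX i ^ n := (hn.strictMono_pow (R := ℝ)).monotone hβ
  linarith

/-- **Even `n = k+1` (`k` odd): `e_{k+1} ≤ (β^X_i − β^Y_i)·(max{0,−β^X_i})ᵏ`.** [ours] -/
theorem sharp_deficit_even (hρX : ∀ i, 0 < ρX i) (hmonoX : Monotone ρX) (hρY : ∀ i, 0 < ρY i) (hmonoY : Monotone ρY)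
    (hagree : ∀ i, i ≠ s → ρX i = ρY i) (htag : ρX s ≤ ρY s) (hN : ∀ i, 0 < N i)
    (hRX : ∀ k, RX k = ∑ i ∈ range k, N i * ρX i) (hRY : ∀ k, RY k = ∑ i ∈ range k, N i * ρY i) (hM : ∀ k, M k = ∑ i ∈ Ico k m, N i)
    (hPXoff : ∀ i j, i ≠ j → PX i j = c * N j * min 1 (ρX j / ρX i)) (hPXdiag : ∀ i, PX i i = 1 - ∑ j ∈ (range m).erase i, PX i j)
    (hPYoff : ∀ i j, i ≠ j → PY i j = c * N j * min 1 (ρY j / ρY i)) (hPYdiag : ∀ i, PY i i = 1 - ∑ j ∈ (range m).erase i, PY i j)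
    (hfX : ∀ k i, fX k i = if i < k then ρX k else if i = k then -(RX k / N k) else 0)
    (hfY : ∀ k i, fY k i = if i < k then ρY k else if i = k then -(RY k / N k) else 0)
    (hβX : ∀ k, βX k = 1 - c * (M k + RX k / ρX k)) (hβY : ∀ k, βY k = 1 - c * (M k + RY k / ρY k)) (ha : ∀ l, a l = 1 - c * M (l + 1))
    (hPX0 : ∀ i j, PnX 0 i j = if i = j then 1 else 0) (hPXs : ∀ n i j, PnX (n + 1) i j = ∑ l ∈ range m, PnX n i l * PX l j)
    (hPY0 : ∀ i j, PnY 0 i j = if i = j then 1 else 0) (hPYs : ∀ n i j, PnY (n + 1) i j = ∑ l ∈ range m, PnY n i l * PY l j)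
    (hTX : ∀ n j, TX n j = (1 - βX j ^ n) / RX m + ∑ k ∈ Ico (j + 1) m, (1 / RX k - 1 / RX (k + 1)) * (βX k ^ n - βX j ^ n))
    (hTY : ∀ n j, TY n j = (1 - βY j ^ n) / RY m + ∑ k ∈ Ico (j + 1) m, (1 / RY k - 1 / RY (k + 1)) * (βY k ^ n - βY j ^ n))
    (hc : 0 ≤ c) (hcK : c * M 0 ≤ 1 + c) {k : ℕ} (hk : Odd k) {i : ℕ} (hsi : s < i) (hi : i < m) (h3 : M (i + 1) + 3 ≤ M 0) (hNi : 1 ≤ N i) :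
    PnY (k + 1) i i - PnX (k + 1) i i ≤ (βX i - βY i) * (max 0 (-βX i)) ^ k := by
  have hstep := sharp_deficit_succ_le hρX hmonoX hρY hmonoY hagree htag hN hRX hRY hM hPXoff hPXdiag hPYoff hPYdiag hfX hfY hβX hβY ha hPX0 hPXs hPY0 hPYs hTX hTY
    hc hcK k hsi hi h3 hNi
  have hodd := sharp_deficit_odd hρX hmonoX hρY hmonoY hagree htag hN hRX hRY hM hPXoff hPXdiag hPYoff hPYdiag hfX hfY hβX hβY ha hPX0 hPXs hPY0 hPYs hTX hTY
    hc hcK hk hsi hi h3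
  rw [max_eq_left hodd, zero_mul, zero_sub] at hstep
  have hγ := sharp_gamma_nonneg hρY hagree htag hN hRX hRY hβX hβY hc hsi
  -- `−(β^X)ᵏ = (−β^X)ᵏ ≤ (max{0,−β^X})ᵏ` for odd `k`
  have hpow : -(βX i ^ k) ≤ (max 0 (-βX i)) ^ k := by
    rw [← hk.neg_pow]
    rcases le_or_gt 0 (-βX i) with h | h
    · rw [max_eq_right h]
    · rw [max_eq_left h.le]
      have : (-βX i) ^ k ≤ 0 := (hk.pow_neg h).le
      have h0 : (0:ℝ) ^ k = 0 := zero_pow (by rintro rfl; exact (Nat.not_odd_zero hk).elim)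
      linarith
  calc PnY (k + 1) i i - PnX (k + 1) i i ≤ -((βX i - βY i) * βX i ^ k) := hstep
    _ = (βX i - βY i) * (-(βX i ^ k)) := by ring
    _ ≤ (βX i - βY i) * (max 0 (-βX i)) ^ k := mul_le_mul_of_nonneg_left hpow hγ

/-- **THE SHARP START-CLASS DEFICIT BOUND, every `n ≥ 1`:** `P_Yⁿ(i,i) − P_Xⁿ(i,i) ≤ (β^X_i − β^Y_i)·(max{0,−β^X_i})ⁿ⁻¹`. [ours] -/
theorem sharp_deficit_le (hρX : ∀ i, 0 < ρX i) (hmonoX : Monotone ρX) (hρY : ∀ i, 0 < ρY i) (hmonoY : Monotone ρY)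
    (hagree : ∀ i, i ≠ s → ρX i = ρY i) (htag : ρX s ≤ ρY s) (hN : ∀ i, 0 < N i)
    (hRX : ∀ k, RX k = ∑ i ∈ range k, N i * ρX i) (hRY : ∀ k, RY k = ∑ i ∈ range k, N i * ρY i) (hM : ∀ k, M k = ∑ i ∈ Ico k m, N i)
    (hPXoff : ∀ i j, i ≠ j → PX i j = c * N j * min 1 (ρX j / ρX i)) (hPXdiag : ∀ i, PX i i = 1 - ∑ j ∈ (range m).erase i, PX i j)
    (hPYoff : ∀ i j, i ≠ j → PY i j = c * N j * min 1 (ρY j / ρY i)) (hPYdiag : ∀ i, PY i i = 1 - ∑ j ∈ (range m).erase i, PY i j)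
    (hfX : ∀ k i, fX k i = if i < k then ρX k else if i = k then -(RX k / N k) else 0)
    (hfY : ∀ k i, fY k i = if i < k then ρY k else if i = k then -(RY k / N k) else 0)
    (hβX : ∀ k, βX k = 1 - c * (M k + RX k / ρX k)) (hβY : ∀ k, βY k = 1 - c * (M k + RY k / ρY k)) (ha : ∀ l, a l = 1 - c * M (l + 1))
    (hPX0 : ∀ i j, PnX 0 i j = if i = j then 1 else 0) (hPXs : ∀ n i j, PnX (n + 1) i j = ∑ l ∈ range m, PnX n i l * PX l j)
    (hPY0 : ∀ i j, PnY 0 i j = if i = j then 1 else 0) (hPYs : ∀ n i j, PnY (n + 1) i j = ∑ l ∈ range m, PnY n i l * PY l j)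
    (hTX : ∀ n j, TX n j = (1 - βX j ^ n) / RX m + ∑ k ∈ Ico (j + 1) m, (1 / RX k - 1 / RX (k + 1)) * (βX k ^ n - βX j ^ n))
    (hTY : ∀ n j, TY n j = (1 - βY j ^ n) / RY m + ∑ k ∈ Ico (j + 1) m, (1 / RY k - 1 / RY (k + 1)) * (βY k ^ n - βY j ^ n))
    (hc : 0 ≤ c) (hcK : c * M 0 ≤ 1 + c) (n : ℕ) {i : ℕ} (hsi : s < i) (hi : i < m) (h3 : M (i + 1) + 3 ≤ M 0) (hNi : 1 ≤ N i) :
    PnY (n + 1) i i - PnX (n + 1) i i ≤ (βX i - βY i) * (max 0 (-βX i)) ^ n := by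
  rcases Nat.even_or_odd n with he | ho
  · -- `n+1` odd: no deficit, and the right side is `≥ 0`
    have hodd : Odd (n + 1) := he.add_one
    have h := sharp_deficit_odd hρX hmonoX hρY hmonoY hagree htag hN hRX hRY hM hPXoff hPXdiag hPYoff hPYdiag hfX hfY hβX hβY ha hPX0 hPXs hPY0 hPYs hTX hTY
      hc hcK hodd hsi hi h3
    have hγ := sharp_gamma_nonneg hρY hagree htag hN hRX hRY hβX hβY hc hsi
    exact h.trans (mul_nonneg hγ (pow_nonneg (le_max_left _ _) n))
  · exact sharp_deficit_even hρX hmonoX hρY hmonoY hagree htag hN hRX hRY hM hPXoff hPXdiag hPYoff hPYdiag hfX hfY hβX hβY ha hPX0 hPXs hPY0 hPYs hTX hTY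
      hc hcK ho hsi hi h3 hNi

/-- **No deficit at all when the start class's eigenvalue in `X` is non-negative:** `β^X_i ≥ 0 ⇒ P_Yⁿ(i,i) ≤ P_Xⁿ(i,i)` for every `n`. [ours] -/
theorem sharp_deficit_le_of_nonneg (hρX : ∀ i, 0 < ρX i) (hmonoX : Monotone ρX) (hρY : ∀ i, 0 < ρY i) (hmonoY : Monotone ρY)
    (hagree : ∀ i, i ≠ s → ρX i = ρY i) (htag : ρX s ≤ ρY s) (hN : ∀ i, 0 < N i)
    (hRX : ∀ k, RX k = ∑ i ∈ range k, N i * ρX i) (hRY : ∀ k, RY k = ∑ i ∈ range k, N i * ρY i) (hM : ∀ k, M k = ∑ i ∈ Ico k m, N i)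
    (hPXoff : ∀ i j, i ≠ j → PX i j = c * N j * min 1 (ρX j / ρX i)) (hPXdiag : ∀ i, PX i i = 1 - ∑ j ∈ (range m).erase i, PX i j)
    (hPYoff : ∀ i j, i ≠ j → PY i j = c * N j * min 1 (ρY j / ρY i)) (hPYdiag : ∀ i, PY i i = 1 - ∑ j ∈ (range m).erase i, PY i j)
    (hfX : ∀ k i, fX k i = if i < k then ρX k else if i = k then -(RX k / N k) else 0)
    (hfY : ∀ k i, fY k i = if i < k then ρY k else if i = k then -(RY k / N k) else 0)
    (hβX : ∀ k, βX k = 1 - c * (M k + RX k / ρX k)) (hβY : ∀ k, βY k = 1 - c * (M k + RY k / ρY k)) (ha : ∀ l, a l = 1 - c * M (l + 1))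
    (hPX0 : ∀ i j, PnX 0 i j = if i = j then 1 else 0) (hPXs : ∀ n i j, PnX (n + 1) i j = ∑ l ∈ range m, PnX n i l * PX l j)
    (hPY0 : ∀ i j, PnY 0 i j = if i = j then 1 else 0) (hPYs : ∀ n i j, PnY (n + 1) i j = ∑ l ∈ range m, PnY n i l * PY l j)
    (hTX : ∀ n j, TX n j = (1 - βX j ^ n) / RX m + ∑ k ∈ Ico (j + 1) m, (1 / RX k - 1 / RX (k + 1)) * (βX k ^ n - βX j ^ n))
    (hTY : ∀ n j, TY n j = (1 - βY j ^ n) / RY m + ∑ k ∈ Ico (j + 1) m, (1 / RY k - 1 / RY (k + 1)) * (βY k ^ n - βY j ^ n))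
    (hc : 0 ≤ c) (hcK : c * M 0 ≤ 1 + c) (n : ℕ) {i : ℕ} (hsi : s < i) (hi : i < m) (h3 : M (i + 1) + 3 ≤ M 0) (hNi : 1 ≤ N i) (hβ : 0 ≤ βX i) :
    PnY n i i ≤ PnX n i i := by
  rcases n with _ | n
  · rw [hPY0, hPX0]
  · have h := sharp_deficit_le hρX hmonoX hρY hmonoY hagree htag hN hRX hRY hM hPXoff hPXdiag hPYoff hPYdiag hfX hfY hβX hβY ha hPX0 hPXs hPY0 hPYs hTX hTY
      hc hcK n hsi hi h3 hNi
    rw [max_eq_left (by linarith : -βX i ≤ 0)] at h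
    rcases n with _ | n
    · -- `n = 0`: the bound is `γ·1`… but `e_1 = −γ ≤ 0` directly from the odd case
      have := sharp_deficit_odd hρX hmonoX hρY hmonoY hagree htag hN hRX hRY hM hPXoff hPXdiag hPYoff hPYdiag hfX hfY hβX hβY ha hPX0 hPXs hPY0 hPYs hTX hTY
        hc hcK (n := 0 + 1) (by norm_num) hsi hi h3
      linarith
    · rw [zero_pow (Nat.succ_ne_zero n), mul_zero] at h
      linarith

/-- **The size of the new bound:** `0 ≤ β^X_i − β^Y_i ≤ c·N_s·ρ^Y_s/ρ_i` and `max{0,−β^X_i} ≤ c` (for the star `c = 1/K`: `e_n ≤ K⁻¹·(N_sρ^Y_s/ρ_ζ)·K^{−(n−1)}·(Kmax{0,−β^X})ⁿ⁻¹`,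
with `K·max{0,−β^X_ζ} ≤ acc(ζ,a)` in the tagged reading). [ours] -/
theorem sharp_gamma_le (hρX : ∀ i, 0 < ρX i) (hmonoX : Monotone ρX) (hN : ∀ i, 0 < N i)
    (hagree : ∀ i, i ≠ s → ρX i = ρY i)
    (hRX : ∀ k, RX k = ∑ i ∈ range k, N i * ρX i) (hRY : ∀ k, RY k = ∑ i ∈ range k, N i * ρY i) (hM : ∀ k, M k = ∑ i ∈ Ico k m, N i)
    (hβX : ∀ k, βX k = 1 - c * (M k + RX k / ρX k)) (hβY : ∀ k, βY k = 1 - c * (M k + RY k / ρY k)) (hc : 0 ≤ c) (hcK : c * M 0 ≤ 1 + c)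
    {i : ℕ} (hsi : s < i) (hi : i < m) :
    βX i - βY i ≤ c * N s * ρY s / ρX i ∧ max 0 (-βX i) ≤ c := by
  refine ⟨?_, ?_⟩
  · rw [sharp_gamma_eq hagree hRX hRY hβX hβY hsi]
    have h1 : c * N s * (ρY s - ρX s) ≤ c * N s * ρY s := by nlinarith [mul_nonneg hc (hN s).le, hρX s]
    exact div_le_div_of_nonneg_right h1 (hρX i).le
  · have h := hubClass_beta_ge hρX hmonoX hN hRX hM hβX hc hi
    exact max_le hc (by linarith)

end Sharp

end Summit.Ventures.LatticeQCDFlow.Scaling
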